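import Summits.QuantumFields.BalabanUV.T4Continuum.Support.B13KPStepTermMeasurableLetters

/-!
# NE5 ∕ U3, route P2 — THE ARITHMETIC CENSUS of route P2's END on Bałaban's carriers of record (skeleton `t4/skeletons/NE5-t4-ne5-p2.md`
# §6 row A5): the numeric binders of `B13KPStepTermMeasurableLetters.ne5_above_max_record_measOp_letters` (p215092) REPLACED BY EXPLICIT
# WITNESSES under ONE rate room, ONE amplitude inequality and the other rows' sign letters (part 1 of 2: the witnesses and the face at every rate
# `θ′ > max(θ, ω)`; part 2 `B13KPStepTermCensusAtRate`: the face AT W1's rate `θ` itself when the age damping is faster, `ω < θ`)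

Cell `pub-balaban`, unit `b2b-balaban-t4-ne5-p2` (NE5 ∕ U3 PROVER seat P2 «polymer-activity Lipschitz ∕ Kotecký–Preiss route», lineage gen 20).
Summits-side new work (cell bookkeeping; NOT a Literature module; nothing of the manuscripts is asserted).  HONEST FRAMING: rung (B)+1 of the
FINITE-VOLUME T⁴ programme — NOT infinite volume, NOT mass gap, NOT Clay, **NOT A PROOF OF NE5** (spine 0∕9): an implication from displayed binders
over NAMED-PARAMETER cores and constants; this file only does ARITHMETIC on the numeric letters of an END face already in the tree.  HONEST
DEPENDENCY (cell line, verbatim): continuum YM on T⁴ ⇐ BetaPertH ∧ nine spine estimates (0/9 proved); BetaPertH ⇐ (D1) ∧ (D4) ∧ CAP+tail;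
G-an2-4 gates asym, D1 and NE2/3/4.

WHAT.  The END of record of route P2 on the measurable operator slot (`…MeasurableLetters.ne5_above_max_record_measOp_letters`, and its twin
`…Measurable.ne5_above_max_record_measOp`) displays, besides the analytic binders (per-term one-run data, ONE (2.38)-shaped inequality
`Σ_ℓ G₀ Z ℓ ≤ A_m·e^{−R_m·d(Z)}`, W1∕W4∕W3, the transport reading), TWENTY-FOUR NUMERIC binders in the free letters `τ, σ, s, ρ₀′` and the
other rows' letters: the L03 numerics (`hA_m hτ hσ hs0 hrate hsmall hσκ`), R-IDENT's window numerics (`hrate' hsmall'`), the reach ∕ inflation ∕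
rate clause (`hρ₁ hρ hs hreach hθ'`) and signs.  [II] p. 21 prints this as «for κ sufficiently large, and ε₁ sufficiently small» (and «we assume
that O(1)C₃ε₁ ≤ ½E₀»); the CONTRACT asks for the exact smallness census.  Here:
* §0 `insertionRate_of_level_le` — W4 (`StepModel.InsertionRate`) is monotone in the table LEVEL (a bound for all tables of level `E₀′` is a
  bound for all tables of level `E₀ ≤ E₀′`), so W4 may be displayed at any level `E_ins` dominating the derived one-run output level;
* §1 **`census_arith`** — THE WITNESSES (pure real arithmetic, no model): with
    `σ := max(ϰ + 1, 1)`, `Mr := max(Λhist∕Λop, 1)`, `ρ₀′ := ρ₀∕(2·Mr)`, `s := Λhist·ρ₀′ + 1`,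
    `K₁ := (2 + Λhist)·9·K₀(64,8)·e^{64}`, `τ := A_m·K₁·e^{5σ}` (so that the derived one-run output level is `64τe^{−5σ} = 64·A_m·K₁`),
  ALL the numeric binders above hold as soon as
    (RATE ROOM)  `64·log 162 + max(ϰ + 1, 1) + 64 ≤ R_m`, and
    (AMPLITUDE)  `A_m·K₁ ≤ min( e^{−5·max(ϰ+1,1)}, ρ₀(1 − ω)∕(512·Mr·(c + 1)), (t − ω)∕(128·(Λhist·c + 1)), E_ins∕64 )`
  for a rate target `t > ω`, the fed-back rate then obeying `r_fb = ω + 64·A_m·K₁·Λhist·c < t`;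
* §2 the CENSUS END FACE on Bałaban's carriers of record (same analytic display as p215092, numeric block = rate room + amplitude + signs):
  **`ne5_record_measOp_census`** — `∃ C₅, NE5 (outA …) (outB …) W ϰ θ′ C₅` for EVERY `θ′ > max(θ, ω)` (amplitude inequality at `t := θ′`).
  (Part 2 `B13KPStepTermCensusAtRate.ne5_at_inputRate_record_measOp_census`: when `ω < θ`, NE5 AT W1's RATE `θ` ITSELF, amplitude
  inequality at `t := θ` — route P2 then loses NO rate.)
READING (census page of the skeleton): in [II]'s letters `A_m` is the (2.38) amplitude `O(1)·C₃ε₁` read in the moduli units `(Λop, Λhist, ρ₀)` of K6's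
per-term majorant `G₀ = size + ampOp∕Λop + ampHist∕Λhist`, `R_m` its tree-length decay rate, `ϰ` the NE5 decay rate asked by the consumers, `θ` W1's rate
(rows NE2 ∧ NE3), `ω`∕`c` W3's age damping ∕ insertion constant, `E_ins` W4's level: «ε₁ sufficiently small» = (AMPLITUDE), «κ sufficiently large» =
(RATE ROOM), the dependence on the rate target displayed (`θ′ − ω`, resp. `θ − ω`).  Every other numeric letter is CHOSEN, none is left displayed.
NOT NE5: the analytic binders (NODE O's cores ∕ constants are NAMED PARAMETERS; W1 = rows NE2 ∧ NE3; W4∕W3 the holder's producers; the transport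
reading) are untouched.  0 sorry; axioms ⊆ {propext, Classical.choice, Quot.sound}.
-/

noncomputable section

open MeasureTheory
open scoped BigOperators

namespace Summit.QuantumFields.BalabanUV.T4Continuum.B13KPStepTermCensus

open Literature.MathematicalPhysics.QuantumFieldTheory.Balaban1983to89
open Literature.MathematicalPhysics.QuantumFieldTheory.Balaban1983to89.T4OutputRate (Carriers Functional DecayBound NE5)
open Literature.MathematicalPhysics.QuantumFieldTheory.Balaban1983to89.T4InputCauchyRateData (StepModel)
open Summit.QuantumFields.BalabanUV.T4Continuum.ActivityTermModel (TermDatum TermConsts TermFamily)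
open Summit.QuantumFields.BalabanUV.T4Continuum.B13Carriers (TwoRuns)
open Summit.QuantumFields.BalabanUV.T4Continuum.B13DomainGeometryTR (domainGeometry)
open Summit.QuantumFields.BalabanUV.T4Continuum.B13InnerData (b13InnerData Bnd)
open Summit.QuantumFields.BalabanUV.T4Continuum.B13HistDatum (level136)
open Summit.QuantumFields.BalabanUV.T4Continuum.B13HistMeasurable (MeasPotFrame)
open Summit.QuantumFields.BalabanUV.T4Continuum.B13StepOfRecord (step outA outB assembly)
open Summit.QuantumFields.BalabanUV.T4Continuum.B13StepTermLabels (InnerLabel innerLabels)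
open Summit.QuantumFields.BalabanUV.T4Continuum.B13KPStepOfRecord (inputA_KP inputB_KP)
open Summit.QuantumFields.BalabanUV.T4Continuum.B13TermData (termData)
open Summit.QuantumFields.BalabanUV.T4Continuum.B13StepOfRecordTermData (TermSlots)
open Summit.QuantumFields.BalabanUV.T4Continuum.B13OpMeasurable (measOp)
open Summit.QuantumFields.BalabanUV.T4Continuum.B13KPStepTermLetters (G₀)
open Summit.QuantumFields.BalabanUV.T4Continuum.B13KPStepTermMeasurableLetters (ne5_above_max_record_measOp_letters)

/-! ## §0 W4 is monotone in the table level -/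

/-- [folklore] **`InsertionRate` IS MONOTONE IN THE LEVEL**: a bound on the two runs' insertion maps over all tables of one-run level `E₀′`
is a bound over all tables of any level `E₀ ≤ E₀′` (the class of tables shrinks). -/
theorem insertionRate_of_level_le {C : Carriers} {Op Hist : Type*} [NormedAddCommGroup Op] [NormedSpace ℂ Op]
    [NormedAddCommGroup Hist] [NormedSpace ℂ Hist] (M : StepModel C Op Hist) {W : Set (ℕ → ℝ)} {κ' E₀ E₀' δ' θ : ℝ}
    (h : M.InsertionRate W κ' E₀' δ' θ) (hle : E₀ ≤ E₀') : M.InsertionRate W κ' E₀ δ' θ := by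
  intro k g hg U t ht
  exact h k g hg U t fun Y => (ht Y).trans (mul_le_mul_of_nonneg_right hle (Real.exp_pos _).le)

variable {𝔾 : Type} [GaugeGroup 𝔾] {R : TwoRuns 𝔾} {P : MeasPotFrame R.carriers} {𝒴 : Type*} {dom : 𝒴 → R.carriers.Dom}
  {T κ ι S Ω Ω₀ 𝒞 IOp : Type*} [MeasurableSpace Ω] [MeasurableSpace Ω₀] [Fintype ι] [Fintype κ] [DecidableEq ι] [DecidableEq κ]
  (𝔖 : TermSlots R P dom T κ ι S Ω Ω₀ 𝒞 IOp) (E₀ cB : ℝ)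
  (hA : ∀ g U k, (step 𝔖.toSlots E₀ cB).opA g U k ∈ measOp T κ ι Ω 𝒴)
  (hB : ∀ g U k, (step 𝔖.toSlots E₀ cB).opB g U k ∈ measOp T κ ι Ω 𝒴)
  (𝔡 : R.carriers.Dom → InnerLabel R.carriers.Dom (Bnd R) → TermConsts)

/-! ## §1 The witnesses (pure arithmetic) -/

/-- [folklore] **THE ARITHMETIC CENSUS — WITNESSES** (stated for ANY positive (1.26)-type constant `K` and rate floor `r₁`: the END of
record uses `K := K₀(64,8)`, `r₁ := 64·log 162`; the block-chain (1.26) of `NE9RecordIneq126Chain` would give `K := 2²⁰ + 1`, `r₁ := 144`).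
Letters: `A_m ≥ 0` (the (2.38) amplitude in moduli units), `R_m` (its decay rate), `ϰ` (the NE5 decay rate), `c ≥ 0`∕`ω < 1` (W3),
`0 < Λop, Λhist`, `0 < ρ₀ ≤ 1` (K6's moduli and reach), a rate target `t > ω`, a W4 level `E_ins`.  With `σ := max(ϰ+1, 1)`,
`Mr := max(Λhist∕Λop, 1)`, `ρ₀′ := ρ₀∕(2Mr)`, `s := Λhist·ρ₀′ + 1`, `K₁ := (2 + Λhist)·9·K·e^{64}`, `τ := A_m·K₁·e^{5σ}` (derived one-run output
level `64τe^{−5σ} = 64·A_m·K₁`), the RATE ROOM `r₁ + σ + 64 ≤ R_m` and the ONE amplitude inequality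
`A_m·K₁ ≤ min(e^{−5σ}, ρ₀(1−ω)∕(512·Mr·(c+1)), (t−ω)∕(128·(Λhist·c+1)), E_ins∕64)` give ALL the numeric binders of route P2's END of record
(`hτ hσ hs0 hrate hsmall hσκ hrate' hsmall' hρ hs hreach`), the fed-back rate `r_fb = ω + 64τe^{−5σ}·Λhist∕(s − Λhist·ρ₀′)·c < t`, and the
level domination `64τe^{−5σ} ≤ E_ins`. -/
theorem census_arith {K r₁ A_m R_m ϰ c ω Λop Λhist ρ₀ t Eins : ℝ} (hK : 0 < K)
    (hA_m : 0 ≤ A_m) (hΛop : 0 < Λop) (hΛhist : 0 < Λhist) (hρ₀ : 0 < ρ₀) (hρ₁ : ρ₀ ≤ 1)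
    (hc : 0 ≤ c) (hω1 : ω < 1) (hωt : ω < t)
    (hR : r₁ + max (ϰ + 1) 1 + 64 ≤ R_m)
    (hAm : A_m * ((2 + Λhist) * 9 * K * Real.exp 64) ≤
      min (min (Real.exp (-(max (ϰ + 1) 1 * 5))) (ρ₀ * (1 - ω) / (512 * max (Λhist / Λop) 1 * (c + 1))))
        (min ((t - ω) / (128 * (Λhist * c + 1))) (Eins / 64))) :
    ∃ τ σ s ρ₀' : ℝ, 0 ≤ τ ∧ 0 ≤ σ ∧ 0 ≤ s ∧
      r₁ + σ + τ * 64 ≤ R_m ∧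
      (1 + s) * A_m * Real.exp (σ * 5 + τ * 64) * K * 9 ≤ τ ∧
      ϰ + 1 ≤ σ ∧ r₁ + 64 ≤ R_m ∧
      36 * (A_m * Real.exp 64 * K) < 1 ∧
      max (Λhist / Λop) 1 * ρ₀' ≤ ρ₀ ∧ Λhist * ρ₀' < s ∧
      c * (τ * 64 * Real.exp (-(σ * 5)) + τ * 64 * Real.exp (-(σ * 5))) / (1 - ω) < ρ₀' ∧
      ω + τ * 64 * Real.exp (-(σ * 5)) * Λhist / (s - Λhist * ρ₀') * c < t ∧
      τ * 64 * Real.exp (-(σ * 5)) ≤ Eins := by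
  set σ := max (ϰ + 1) 1 with hσdef
  set Mr := max (Λhist / Λop) 1 with hMrdef
  set K1 := (2 + Λhist) * 9 * K * Real.exp 64 with hK1def
  have hσ1 : 1 ≤ σ := le_max_right _ _
  have hMr1 : 1 ≤ Mr := le_max_right _ _
  have hMr : 0 < Mr := lt_of_lt_of_le one_pos hMr1
  have he64 : 0 < Real.exp 64 := Real.exp_pos _
  have hK1 : 0 < K1 := by positivity
  have hAK : 0 ≤ A_m * K1 := mul_nonneg hA_m hK1.le
  rw [le_min_iff, le_min_iff, le_min_iff] at hAm
  obtain ⟨⟨h1, h2⟩, h3, h4⟩ := hAm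
  -- the witnesses
  set e5 := Real.exp (σ * 5) with he5def
  have he5 : 0 < e5 := Real.exp_pos _
  set τ := A_m * K1 * e5 with hτdef
  set ρ₀' := ρ₀ / (2 * Mr) with hρ₀'def
  set s := Λhist * ρ₀' + 1 with hsdef
  have hω' : 0 < 1 - ω := by linarith
  -- the derived level
  have hAeq : τ * 64 * Real.exp (-(σ * 5)) = 64 * (A_m * K1) := by
    rw [hτdef, Real.exp_neg, he5def]
    field_simp
  -- τ ≤ 1
  have hτ1 : τ ≤ 1 := by
    calc τ = A_m * K1 * e5 := rfl
      _ ≤ Real.exp (-(σ * 5)) * e5 := mul_le_mul_of_nonneg_right h1 he5.le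
      _ = 1 := by rw [he5def, ← Real.exp_add]; simp
  have hτ0 : 0 ≤ τ := by positivity
  have hρ₀'pos : 0 < ρ₀' := by positivity
  have hρ₀'le : ρ₀' ≤ 1 := by
    have h2Mr : (2 : ℝ) ≤ 2 * Mr := by linarith
    calc ρ₀' = ρ₀ / (2 * Mr) := rfl
      _ ≤ ρ₀ / 2 := div_le_div_of_nonneg_left hρ₀.le (by norm_num) h2Mr
      _ ≤ 1 := by linarith
  -- (5) the KP smallness at the witnesses
  have hsmall : (1 + s) * A_m * Real.exp (σ * 5 + τ * 64) * K * 9 ≤ τ := by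
    have hs_le : 1 + s ≤ 2 + Λhist := by
      have := mul_le_mul_of_nonneg_left hρ₀'le hΛhist.le
      simp only [hsdef, mul_one] at this ⊢
      linarith
    have hexp : Real.exp (σ * 5 + τ * 64) ≤ e5 * Real.exp 64 := by
      rw [Real.exp_add]
      exact mul_le_mul_of_nonneg_left (Real.exp_le_exp.2 (by linarith)) he5.le
    have key : (1 + s) * Real.exp (σ * 5 + τ * 64) ≤ (2 + Λhist) * (e5 * Real.exp 64) :=
      mul_le_mul hs_le hexp (Real.exp_pos _).le (by positivity)
    have e1 : (1 + s) * A_m * Real.exp (σ * 5 + τ * 64) * K * 9 = ((1 + s) * Real.exp (σ * 5 + τ * 64)) * (A_m * K * 9) := by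
      ring
    rw [e1]
    calc (1 + s) * Real.exp (σ * 5 + τ * 64) * (A_m * K * 9)
        ≤ (2 + Λhist) * (e5 * Real.exp 64) * (A_m * K * 9) := mul_le_mul_of_nonneg_right key (by positivity)
      _ = τ := by rw [hτdef, hK1def]; ring
  -- (8) the window smallness
  have hsmall' : 36 * (A_m * Real.exp 64 * K) < 1 := by
    have hsplit : A_m * K1 = 18 * (A_m * Real.exp 64 * K) + 9 * Λhist * (A_m * Real.exp 64 * K) := by
      rw [hK1def]; ring
    have hnn : 0 ≤ 9 * Λhist * (A_m * Real.exp 64 * K) := by positivity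
    have hexp5 : Real.exp (-(σ * 5)) ≤ Real.exp (-5) := Real.exp_le_exp.2 (by linarith)
    have h2lt : (2 : ℝ) < Real.exp 5 := by
      have := Real.add_one_le_exp (5 : ℝ)
      linarith
    have hhalf : Real.exp (-5) < 1 / 2 := by
      rw [Real.exp_neg, inv_eq_one_div]
      exact one_div_lt_one_div_of_lt (by norm_num) h2lt
    linarith
  -- (9) the joint reach
  have hρ : Mr * ρ₀' ≤ ρ₀ := by
    have e : Mr * ρ₀' = ρ₀ / 2 := by
      rw [hρ₀'def]
      field_simp
    rw [e]
    linarith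
  -- (11) the accumulated fed-back reach
  have hreach : c * (τ * 64 * Real.exp (-(σ * 5)) + τ * 64 * Real.exp (-(σ * 5))) / (1 - ω) < ρ₀' := by
    rw [hAeq]
    have hc1 : c / (c + 1) ≤ 1 := by
      rw [div_le_one (by linarith)]
      linarith
    have hq : 0 ≤ ρ₀ * (1 - ω) / (4 * Mr) := div_nonneg (mul_nonneg hρ₀.le hω'.le) (by positivity)
    have hnum : c * (64 * (A_m * K1) + 64 * (A_m * K1)) ≤ ρ₀ * (1 - ω) / (4 * Mr) := by
      calc c * (64 * (A_m * K1) + 64 * (A_m * K1)) = 128 * c * (A_m * K1) := by ring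
        _ ≤ 128 * c * (ρ₀ * (1 - ω) / (512 * Mr * (c + 1))) := mul_le_mul_of_nonneg_left h2 (by positivity)
        _ = c / (c + 1) * (ρ₀ * (1 - ω) / (4 * Mr)) := by
          field_simp
          ring
        _ ≤ 1 * (ρ₀ * (1 - ω) / (4 * Mr)) := mul_le_mul_of_nonneg_right hc1 hq
        _ = ρ₀ * (1 - ω) / (4 * Mr) := one_mul _
    calc c * (64 * (A_m * K1) + 64 * (A_m * K1)) / (1 - ω)
        ≤ ρ₀ * (1 - ω) / (4 * Mr) / (1 - ω) := div_le_div_of_nonneg_right hnum hω'.le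
      _ = ρ₀ / (4 * Mr) := by field_simp
      _ < ρ₀ / (2 * Mr) := div_lt_div_of_pos_left hρ₀ (by positivity) (by linarith)
      _ = ρ₀' := rfl
  -- (12) the fed-back rate is below the target
  have hfb : ω + τ * 64 * Real.exp (-(σ * 5)) * Λhist / (s - Λhist * ρ₀') * c < t := by
    rw [hAeq]
    have hs1 : s - Λhist * ρ₀' = 1 := by rw [hsdef]; ring
    rw [hs1, div_one]
    have hL1 : Λhist * c / (Λhist * c + 1) ≤ 1 := by
      rw [div_le_one (by positivity)]
      linarith
    have hto : 0 ≤ (t - ω) / 2 := by linarith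
    have hnum : 64 * (A_m * K1) * Λhist * c ≤ (t - ω) / 2 := by
      calc 64 * (A_m * K1) * Λhist * c ≤ 64 * ((t - ω) / (128 * (Λhist * c + 1))) * Λhist * c :=
            mul_le_mul_of_nonneg_right (mul_le_mul_of_nonneg_right (mul_le_mul_of_nonneg_left h3 (by norm_num)) hΛhist.le) hc
        _ = Λhist * c / (Λhist * c + 1) * ((t - ω) / 2) := by
          field_simp
          ring
        _ ≤ 1 * ((t - ω) / 2) := mul_le_mul_of_nonneg_right hL1 hto
        _ = (t - ω) / 2 := one_mul _
    linarith
  -- (13) the level domination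
  have hlev : τ * 64 * Real.exp (-(σ * 5)) ≤ Eins := by
    rw [hAeq]
    linarith
  refine ⟨τ, σ, s, ρ₀', hτ0, by linarith, by positivity, by linarith, hsmall, le_max_left _ _, by linarith, hsmall', hρ,
    by simp only [hsdef]; linarith, hreach, hfb, hlev⟩

/-! ## §2 The census END face on Bałaban's carriers of record, at every rate above `max(θ, ω)` -/

variable [DecidableEq 𝒞]

include hA hB in
/-- [folklore] **ROUTE P2's END ON BAŁABAN's CARRIERS OF RECORD — THE ARITHMETIC CENSUS FORM, at every rate `θ′ > max(θ, ω)`.**  The END of record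
`B13KPStepTermMeasurableLetters.ne5_above_max_record_measOp_letters` (p215092) with its numeric block REPLACED by: the other rows' sign letters
(`0 < E₁`, `0 < Λop, Λhist`, `0 < ρ₀ ≤ 1`, `0 ≤ δ, δ′, c`, `0 ≤ θ < 1`, `0 < ω < 1`, `0 ≤ A_m`), the rate clause `θ < θ′ ∧ ω < θ′`, ONE RATE ROOM
`64·log 162 + max(ϰ+1, 1) + 64 ≤ R_m` («κ sufficiently large»), and ONE AMPLITUDE INEQUALITY
`A_m·(2+Λhist)·9·K₀(64,8)·e^{64} ≤ min(e^{−5·max(ϰ+1,1)}, ρ₀(1−ω)∕(512·max(Λhist∕Λop,1)·(c+1)), (θ′−ω)∕(128·(Λhist·c+1)), E_ins∕64)` («ε₁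
sufficiently small», the `θ′`-dependence displayed); W4 displayed at any level `E_ins` (§0).  Analytic display unchanged: per catalogued term of
record `Admissible`, `GeometryCore`, the B13-format letters, measurability side conditions, `RefAt` at both runs' own input points, ONE (2.38)-shaped
inequality; W1∕W4∕W3 of the step of record; the holder's transport reading.  NOT a proof of NE5. -/
theorem ne5_record_measOp_census (hT : (assembly 𝔖.toSlots).TransportReads Set.univ) {W : Set (ℕ → ℝ)}
    (hF : ∀ k, 𝔖.F k = (𝔖.G k).format) {lamR : ℝ}
    {A_m R_m E₁ Eins ϰ θ δ δ' c ω Λop Λhist ρ₀ : ℝ}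
    -- per catalogued term of record: admissible constants, lattice geometry, B13-format letters; measurability side conditions
    (hadm : ∀ k, ∀ Z ∈ (domainGeometry R).level k, ∀ ℓ ∈ innerLabels (b13InnerData R) k Z, (𝔡 Z ℓ).Admissible)
    (hcore : ∀ k, ∀ Z ∈ (domainGeometry R).level k, ∀ ℓ ∈ innerLabels (b13InnerData R) k Z,
      (termData 𝔖.F 𝔖.G 𝔖.rHist 𝔖.core Z ℓ).GeometryCore (𝔡 Z ℓ))
    (hδ : ∀ k, ∀ Z ∈ (domainGeometry R).level k, ∀ ℓ ∈ innerLabels (b13InnerData R) k Z, (𝔖.G k).δ = (𝔡 Z ℓ).δ)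
    (hvR : ∀ k, ∀ Z ∈ (domainGeometry R).level k, ∀ ℓ ∈ innerLabels (b13InnerData R) k Z, ∀ Y ∈ (𝔖.core Z ℓ).D,
      (𝔖.G k).v Y ≤ lamR * (𝔖.rHist k * (‖(𝔖.G k).τ Y‖ * level136 P.consts (R.carriers.d (dom Y)))))
    (hκL : ∀ k, ∀ Z ∈ (domainGeometry R).level k, ∀ ℓ ∈ innerLabels (b13InnerData R) k Z, 𝔖.rOp k ≤ (𝔡 Z ℓ).κL)
    (hκA : ∀ k, ∀ Z ∈ (domainGeometry R).level k, ∀ ℓ ∈ innerLabels (b13InnerData R) k Z, 𝔖.rOp k ≤ (𝔡 Z ℓ).κA)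
    (hκP : ∀ k, ∀ Z ∈ (domainGeometry R).level k, ∀ ℓ ∈ innerLabels (b13InnerData R) k Z, 𝔖.rOp k ≤ (𝔡 Z ℓ).κP)
    (hκQ : ∀ k, ∀ Z ∈ (domainGeometry R).level k, ∀ ℓ ∈ innerLabels (b13InnerData R) k Z, 𝔖.rOp k ≤ (𝔡 Z ℓ).κQ)
    (hκR : ∀ k, ∀ Z ∈ (domainGeometry R).level k, ∀ ℓ ∈ innerLabels (b13InnerData R) k Z, 𝔖.rOp k * lamR ≤ (𝔡 Z ℓ).κR)
    (hXf : ∀ Z ℓ i, Measurable fun x => (𝔖.core Z ℓ).Xf x i) (hBf : ∀ Z ℓ a, Measurable fun x => (𝔖.core Z ℓ).Bf x a)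
    -- L03: ONE (2.38)-shaped inequality on the summed per-term majorants (in the moduli units `Λop, Λhist`, reach `ρ₀`)
    (h238 : ∀ k, ∀ Z ∈ (domainGeometry R).level k,
      ∑ ℓ ∈ innerLabels (b13InnerData R) k Z, G₀ 𝔖 𝔡 Λop Λhist ρ₀ Z ℓ ≤ A_m * Real.exp (-(R_m * R.carriers.d Z)))
    -- L06 at BOTH runs' own input points of record
    (hRef : ∀ g ∈ W, ∀ (U : R.carriers.BgB) (X : R.carriers.Dom),
      ∀ Z ∈ (domainGeometry R).level (R.carriers.scale X), ∀ ℓ ∈ innerLabels (b13InnerData R) (R.carriers.scale X) Z,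
        (termData 𝔖.F 𝔖.G 𝔖.rHist 𝔖.core Z ℓ).RefAt (𝔡 Z ℓ) (inputB_KP 𝔖.toSlots E₀ cB g U X))
    (hRefA : ∀ g ∈ W, ∀ (U : R.carriers.BgB) (X : R.carriers.Dom),
      ∀ Z ∈ (domainGeometry R).level (R.carriers.scale X), ∀ ℓ ∈ innerLabels (b13InnerData R) (R.carriers.scale X) Z,
        (termData 𝔖.F 𝔖.G 𝔖.rHist 𝔖.core Z ℓ).RefAt (𝔡 Z ℓ) (inputA_KP 𝔖.toSlots E₀ cB g U X))
    -- W1, W4 (at any level `E_ins` dominating the derived one), W3 of the step of record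
    (hop : (step 𝔖.toSlots E₀ cB).OperatorRate W δ θ)
    (hins : (step 𝔖.toSlots E₀ cB).InsertionRate W ϰ Eins δ' θ)
    (hunit : (step 𝔖.toSlots E₀ cB).InsScaleBound W ϰ E₁ c ω)
    -- the other rows' sign letters
    (hE₁ : 0 < E₁) (hΛop : 0 < Λop) (hΛhist : 0 < Λhist) (hρ₀ : 0 < ρ₀) (hρ₁ : ρ₀ ≤ 1)
    (hδ0 : 0 ≤ δ) (hδ' : 0 ≤ δ') (hθ : 0 ≤ θ) (hθ1 : θ < 1) (hc : 0 ≤ c) (hω : 0 < ω) (hω1 : ω < 1) (hA_m : 0 ≤ A_m)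
    -- THE CENSUS: one rate room, the rate clause, one amplitude inequality
    (hR : 64 * Real.log 162 + max (ϰ + 1) 1 + 64 ≤ R_m)
    {θ' : ℝ} (hθθ' : θ < θ') (hωθ' : ω < θ')
    (hAm : A_m * ((2 + Λhist) * 9 * B12TreeDecay.K₀ (4 * 2 ^ 4) (2 * 4) * Real.exp 64) ≤
      min (min (Real.exp (-(max (ϰ + 1) 1 * 5))) (ρ₀ * (1 - ω) / (512 * max (Λhist / Λop) 1 * (c + 1))))
        (min ((θ' - ω) / (128 * (Λhist * c + 1))) (Eins / 64))) :
    ∃ C₅, NE5 (outA 𝔖.toSlots E₀ cB) (outB 𝔖.toSlots E₀ cB) W ϰ θ' C₅ := by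
  obtain ⟨τ, σ, s, ρ₀', hτ, hσ, hs0, hrate, hsmall, hσκ, hrate', hsmall', hρ, hs, hreach, hfb, hlev⟩ :=
    census_arith (B12TreeDecay.K₀_pos _ _) hA_m hΛop hΛhist hρ₀ hρ₁ hc hω1 hωθ' hR hAm
  exact ne5_above_max_record_measOp_letters 𝔖 E₀ cB hA hB 𝔡 hT hF hA_m hτ hσ hs0 hrate hsmall hσκ hrate' hsmall' hadm hcore hδ hvR
    hκL hκA hκP hκQ hκR hXf hBf h238 hρ₁ hRef hRefA hop (insertionRate_of_level_le _ hins hlev) hunit hE₁ hΛop hΛhist hρ hs hδ0 hδ'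
    hθ hθ1 hc hω hω1 hreach (max_lt hθθ' hfb)

end Summit.QuantumFields.BalabanUV.T4Continuum.B13KPStepTermCensus

end
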